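import Mathlib
import Summits.AtomisticToContinuum.HydrodynamicLimit.Theses.CollisionIsometryCLT

/-!
# Sketch — first lemmas of the crux-idea cards for `AdaptedWeightCLT` (stmt-AtomisticToContinuum-12949)

Ideator 3, round 1.  Each `def … : Prop` below is the FIRST CHECKABLE STATEMENT of one card
(no proofs at this stage; the file must elaborate).

* card `tagged-frame-sector-contraction` : `ParsevalFrame`, `FluxBiasThreeHalves`
* card `equilibrium-anchor-variance-transfer` : `CovarianceTransferStep`, `EquilibriumAnchor`
* card `logconcave-skeleton-marginals` : `FluxTiltSubMaxwellian`
-/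

namespace Summit.AtomisticToContinuum.HydrodynamicLimit.Cruxes.AdaptedWeightCLT.Ideas

open scoped BigOperators Topology ENNReal
open MeasureTheory Filter Set Matrix

/-! ## Card `tagged-frame-sector-contraction` -/

/-- Orthogonal projection onto the line `ℝ ω` as a `3 × 3` matrix (outer product; `ω` a unit
vector in the intended use). -/
noncomputable def projLine (ω : Fin 3 → ℝ) : Matrix (Fin 3) (Fin 3) ℝ := vecMulVec ω ω

/-- Projection onto the plane `ω^⊥`: the tangential part kept by a sphere in a collision with
normal `ω`. -/
noncomputable def projPerp (ω : Fin 3 → ℝ) : Matrix (Fin 3) (Fin 3) ℝ := 1 - projLine ω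

/-- Memory operator of one sphere along its OWN collision-normal sequence `ω₁, …, ω_m`
(chronological list): `A = P⊥(ω_m) ⋯ P⊥(ω₁)`. -/
noncomputable def memoryOp (l : List (Fin 3 → ℝ)) : Matrix (Fin 3) (Fin 3) ℝ :=
  l.foldl (fun A ω => projPerp ω * A) 1

/-- Gram matrix `Σ_c w_c w_cᵀ` of the frame vectors `w_c = P⊥(ω_m) ⋯ P⊥(ω_{c+1}) ω_c` along
which the received normal momenta `π_c` are remembered: `v(s) = A v(s-Δ) + Σ_c π_c w_c`. -/
noncomputable def frameGram (l : List (Fin 3 → ℝ)) : Matrix (Fin 3) (Fin 3) ℝ :=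
  l.foldl (fun G ω => projPerp ω * G * projPerp ω + projLine ω) 0

/-- **Parseval frame identity** (first lemma of card `tagged-frame-sector-contraction`): for every
finite sequence of unit normals, `A Aᵀ + Σ_c w_c w_cᵀ = 1`. One-sphere Lindeberg normalisation of
the continued-projection expansion; the last frame vector always has `|w_m| = 1`. -/
def ParsevalFrame : Prop :=
  ∀ l : List (Fin 3 → ℝ), (∀ ω ∈ l, dotProduct ω ω = 1) →
    memoryOp l * (memoryOp l)ᵀ + frameGram l = 1

/-- **Flux bias of received normal momenta** (θ = 1): if `a, π` are independent standard
Gaussians (own and partner normal velocity components) and collisions are sampled with the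
hard-sphere flux weight `|a - π|`, then `E_flux[π²] = 3/2` (not `1`):
`∫∫ π² |a-π| dγ dγ = (3/2) ∫∫ |a-π| dγ dγ`.  The naive "independent kicks" caricature of the
adapted-weight CLT therefore returns temperature `3θ/2`; the correct `θ` needs the kick
anticorrelation `E_flux[a π] = -1/2` and residence-time weights. -/
def FluxBiasThreeHalves : Prop :=
  (∫ a, ∫ p, p ^ 2 * |a - p| ∂(ProbabilityTheory.gaussianReal 0 1)
      ∂(ProbabilityTheory.gaussianReal 0 1))
    = (3 / 2) * ∫ a, ∫ p, |a - p| ∂(ProbabilityTheory.gaussianReal 0 1)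
      ∂(ProbabilityTheory.gaussianReal 0 1)

/-! ## Card `equilibrium-anchor-variance-transfer` -/

/-- **Covariance transfer step** (first lemma of card `equilibrium-anchor-variance-transfer`):
reweighting a probability law by a square-integrable density `ρ` moves the mean of `F` by at
most `SD(ρ)·SD(F)` (Cauchy–Schwarz for `Cov(ρ, F)`). Telescoped along a local-Gibbs homotopy
`κ ↦ (a_κ, u_κ, θ_κ)` from the invariant Gibbs law in `N` steps it gives
`|E₁ F - E₀ F| ≤ C √N · sup_κ SD_κ(F)`. -/
def CovarianceTransferStep : Prop :=
  ∀ (Ω : Type) [MeasurableSpace Ω] (μ : Measure Ω) [IsProbabilityMeasure μ] (ρ F : Ω → ℝ),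
    Measurable ρ → (∀ x, 0 ≤ ρ x) → ∫ x, ρ x ∂μ = 1 → MemLp ρ 2 μ → MemLp F 2 μ →
    |(∫ x, F x ∂(μ.withDensity fun x => ENNReal.ofReal (ρ x))) - ∫ x, F x ∂μ|
      ≤ Real.sqrt (ProbabilityTheory.variance ρ μ) * Real.sqrt (ProbabilityTheory.variance F μ)

/-- **Equilibrium anchor** (second checkable statement of card
`equilibrium-anchor-variance-transfer`; the `κ = 0` end of the homotopy): the conclusion of
`FastMomentRelaxation` for CONSTANT profiles `(a, 0, θ)`, i.e. under the (flow-invariant)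
homogeneous Gibbs law the block traceless kinetic stress and kinetic heat flux vanish in
`L²([0,t] × 𝕋³)` in probability — a STATIC law of large numbers (velocities i.i.d. Maxwellian
given positions). Text = body of `FastMomentRelaxation` with `a₀ := a`, `u₀ := 0`, `θ₀ := θ`. -/
def EquilibriumAnchor : Prop :=
  ∀ (a θ : ℝ), 0 < a → 0 < θ →
    let a₀ : UnitAddTorus (Fin 3) → ℝ := fun _ => a
    let θ₀ : UnitAddTorus (Fin 3) → ℝ := fun _ => θ
    let u₀ : UnitAddTorus (Fin 3) → EuclideanSpace ℝ (Fin 3) := fun _ => 0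
    ∃ σ₀ : ℝ, 0 < σ₀ ∧ ∀ σ : ℝ, 0 < σ → σ < σ₀ → ∀ Φ : (N : ℕ) → Literature.Analysis.FluidPDE.HardSphereFlow (Literature.Analysis.FluidPDE.Torus.geometry (Fin 3)) (Literature.MathematicalPhysics.KineticTheory.hsDiameter σ N) (N + 1), ∀ (γ C : ℝ) (φ : ℕ → (UnitAddTorus (Fin 3)) → ℝ), 0 < γ → γ ≤ 1 / 15 → ((∀ N, Literature.Analysis.FunctionSpaces.Torus.IsSmooth (φ N)) ∧ (∀ N y, 0 ≤ φ N y) ∧ (∀ N, ∫ y, φ N y = 1) ∧ (∀ (N : ℕ) y, ((N : ℝ) + 1) ^ (-γ) ≤ Literature.Analysis.FluidPDE.Torus.euclidDist y 0 → φ N y = 0) ∧ (∀ (N : ℕ) y, φ N y ≤ C * ((N : ℝ) + 1) ^ (3 * γ)) ∧ (∀ (N : ℕ) y, ‖Literature.Analysis.FunctionSpaces.Torus.gradient (φ N) y‖ ≤ C * ((N : ℝ) + 1) ^ (4 * γ))) → let ρb := fun (N : ℕ) (z : Literature.Analysis.FluidPDE.Config (N + 1) (Fin 3) (UnitAddTorus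 (Fin 3))) (x : (UnitAddTorus (Fin 3))) => Literature.MathematicalPhysics.KineticTheory.empiricalDensityField z (fun y => φ N (y - x)); let mb := fun (N : ℕ) (z : Literature.Analysis.FluidPDE.Config (N + 1) (Fin 3) (UnitAddTorus (Fin 3))) (x : (UnitAddTorus (Fin 3))) => Literature.MathematicalPhysics.KineticTheory.empiricalMomentumField z (fun y => φ N (y - x)); let ub := fun (N : ℕ) (z : Literature.Analysis.FluidPDE.Config (N + 1) (Fin 3) (UnitAddTorus (Fin 3))) (x : (UnitAddTorus (Fin 3))) => (ρb N z x)⁻¹ • mb N z x; let D := fun (N : ℕ) (z : Literature.Analysis.FluidPDE.Config (N + 1) (Fin 3) (UnitAddTorus (Fin 3))) (x : (UnitAddTorus (Fin 3))) (j k : Fin 3) => (∫ y, φ N (y.1 - x) * ((y.2 j - ub N z x j) * (y.2 k - ub N z x k)) ∂(Literature.Analysis.FluidPDE.empiricalMeasure z)) - (if j = k then (∑ l : Fin 3, ∫ y, φ N (y.1 - x) * (y.2 l - ub N z x l) ^ 2 ∂(Literature.Analysis.FluidPDE.empiricalMeasure z)) / 3 else 0); let q := fun (N : ℕ) (z : Literature.Analysis.FluidPDE.Config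 (N + 1) (Fin 3) (UnitAddTorus (Fin 3))) (x : (UnitAddTorus (Fin 3))) => ∫ y, (φ N (y.1 - x) * ‖y.2 - ub N z x‖ ^ 2 / 2) • (y.2 - ub N z x) ∂(Literature.Analysis.FluidPDE.empiricalMeasure z); ∀ t : ℝ, 0 < t → ∀ δ : ℝ, 0 < δ → Tendsto (fun N : ℕ => Literature.MathematicalPhysics.KineticTheory.localGibbsLaw σ a₀ u₀ θ₀ N (Φ N) {z | δ < ∫ s in Icc 0 t, ∫ x, ((∑ j, ∑ k, D N ((Φ N).flow s z) x j k ^ 2) + ‖q N ((Φ N).flow s z) x‖ ^ 2)}) atTop (𝓝 0)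

/-! ## Card `logconcave-skeleton-marginals` -/

/-- **Flux-tilted Gaussians are sub-Maxwellian in every direction** (first lemma of card
`logconcave-skeleton-marginals`; Brascamp–Lieb for the potential `|x|²/(2θ) - Σ_c log(ℓ_c·x)`,
whose Hessian is `≥ 𝟙/θ` on the cone `{ℓ_c·x > 0}`): for the law with density
`exp(-|x|²/2θ) · Π_c (ℓ_c·x)₊` on `ℝⁿ` (ancestor velocities given a Boltzmann collision tree:
Maxwellian product times the positive linear flux factors `(g_c·ω_c)₊`), every linear marginal
`⟨r, X⟩` has variance `≤ θ |r|²`. With the row isometry `Σ_k M_ik M_ikᵀ = 1` this says: GIVEN the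
skeleton, the output velocity `ξ_i = Σ_k M_ik η_k` has directional variances `≤ θ`; anisotropy
given the tree can only be a deficit, made up across trees by the variance of conditional means. -/
def FluxTiltSubMaxwellian : Prop :=
  ∀ (n m : ℕ) (θ : ℝ), 0 < θ → ∀ (ℓ : Fin m → (Fin n → ℝ)) (r : Fin n → ℝ),
    let w : (Fin n → ℝ) → ℝ :=
      fun x => Real.exp (-(dotProduct x x) / (2 * θ)) * ∏ c, max (dotProduct (ℓ c) x) 0
    let μ : Measure (Fin n → ℝ) := volume.withDensity fun x => ENNReal.ofReal (w x)
    μ univ ≠ 0 →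
      ProbabilityTheory.variance (fun x => dotProduct r x) ((μ univ)⁻¹ • μ) ≤ θ * dotProduct r r

end Summit.AtomisticToContinuum.HydrodynamicLimit.Cruxes.AdaptedWeightCLT.Ideas

namespace Summit.AtomisticToContinuum.HydrodynamicLimit.Cruxes.AdaptedWeightCLT.Ideas

open Matrix

theorem projLine_mul_projLine (ω : Fin 3 → ℝ) (h : dotProduct ω ω = 1) :
    projLine ω * projLine ω = projLine ω := by
  ext i j
  simp only [projLine, Matrix.mul_apply, vecMulVec_apply]
  have : ∑ x : Fin 3, ω i * ω x * (ω x * ω j) = ω i * ω j * ∑ x : Fin 3, ω x * ω x := by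
    rw [Finset.mul_sum]; refine Finset.sum_congr rfl fun x _ => by ring
  rw [this]
  have h' : ∑ x : Fin 3, ω x * ω x = 1 := by simpa [dotProduct] using h
  rw [h', mul_one]

theorem projPerp_transpose (ω : Fin 3 → ℝ) : (projPerp ω)ᵀ = projPerp ω := by
  ext i j
  simp [projPerp, projLine, vecMulVec_apply, Matrix.transpose_apply, Matrix.sub_apply,
    Matrix.one_apply, mul_comm, eq_comm]

theorem projPerp_sq_add_projLine (ω : Fin 3 → ℝ) (h : dotProduct ω ω = 1) :
    projPerp ω * projPerp ω + projLine ω = 1 := by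
  have hQ := projLine_mul_projLine ω h
  simp only [projPerp, sub_mul, mul_sub, one_mul, mul_one, hQ]
  abel

/-- Proof of the Parseval frame identity by induction on the normal sequence. -/
theorem parsevalFrame_holds : ParsevalFrame := by
  intro l hl
  suffices key : ∀ (l : List (Fin 3 → ℝ)) (A G : Matrix (Fin 3) (Fin 3) ℝ),
      (∀ ω ∈ l, dotProduct ω ω = 1) → A * Aᵀ + G = 1 →
      (l.foldl (fun A ω => projPerp ω * A) A) * (l.foldl (fun A ω => projPerp ω * A) A)ᵀ
        + l.foldl (fun G ω => projPerp ω * G * projPerp ω + projLine ω) G = 1 by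
    simpa [memoryOp, frameGram] using key l 1 0 hl (by simp)
  intro l
  induction l with
  | nil => intro A G _ h; simpa using h
  | cons ω l ih =>
    intro A G hωl hAG
    simp only [List.foldl_cons]
    apply ih
    · exact fun ω' h' => hωl ω' (List.mem_cons_of_mem _ h')
    · have hω : dotProduct ω ω = 1 := hωl ω List.mem_cons_self
      have hP := projPerp_transpose ω
      calc projPerp ω * A * (projPerp ω * A)ᵀ + (projPerp ω * G * projPerp ω + projLine ω)
          = projPerp ω * (A * Aᵀ + G) * projPerp ω + projLine ω := by
            rw [Matrix.transpose_mul, hP]; noncomm_ring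
        _ = 1 := by rw [hAG, mul_one, projPerp_sq_add_projLine ω hω]

end Summit.AtomisticToContinuum.HydrodynamicLimit.Cruxes.AdaptedWeightCLT.Ideas

/-! ## Card `invariant-gibbs-superexp-transfer` -/

namespace Summit.AtomisticToContinuum.HydrodynamicLimit.Cruxes.AdaptedWeightCLT.Ideas

open scoped BigOperators Topology ENNReal
open MeasureTheory Filter Set

/-- **Entropy-inequality transfer** (Kipnis–Landim App. 1 Prop. 8.2; first lemma of card
`invariant-gibbs-superexp-transfer`): for probability laws `P ≪ G` and an event `A` with
`G A ≠ 0`, `P(A) ≤ (log 2 + H(P | G)) / log(1 + 1/G(A))`. Used with `G` = the flow-invariant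
homogeneous Gibbs law, `P` = the time-`t` law (`H(P_t|G) = H(P_0|G) ≤ C(N+1)` for all `t`). -/
def EntropyInequalityTransfer : Prop :=
  ∀ (Ω : Type) [MeasurableSpace Ω] (P G : Measure Ω) [IsProbabilityMeasure P]
    [IsProbabilityMeasure G] (A : Set Ω), MeasurableSet A → P ≪ G → G A ≠ 0 →
    InformationTheory.klDiv P G ≠ ∞ →
    (P A).toReal ≤ (Real.log 2 + (InformationTheory.klDiv P G).toReal)
      / Real.log (1 + ((G A).toReal)⁻¹)

/-- **Equilibrium super-exponential rarity of a sustained kinetic flux defect** (the transfer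
target `C⁺` of card `invariant-gibbs-superexp-transfer`, typed): under the homogeneous Gibbs law
with constant profiles `(a, 0, θ)` (flow-invariant, `HomogeneousInvariance`), for every admissible
kernel family, `t, δ > 0`, tail parameters `λ, C_exp` and EVERY rate `c`, eventually in `N` the
event "time-integrated block traceless kinetic stress + kinetic heat flux exceeds `δ` on `[0,t]`
WHILE the time-averaged exponential velocity moment is `≤ C_exp`" has probability
`≤ exp(-c (N+1))`. The velocity-tail guard is necessary: one sphere of speed `≍ N^{(2-3γ)/4}`
produces the defect at sub-exponential Gaussian cost. -/
def EqSustainedFluxDefect : Prop :=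
  ∀ (a θ : ℝ), 0 < a → 0 < θ →
    let a₀ : UnitAddTorus (Fin 3) → ℝ := fun _ => a
    let θ₀ : UnitAddTorus (Fin 3) → ℝ := fun _ => θ
    let u₀ : UnitAddTorus (Fin 3) → EuclideanSpace ℝ (Fin 3) := fun _ => 0
    ∃ σ₀ : ℝ, 0 < σ₀ ∧ ∀ σ : ℝ, 0 < σ → σ < σ₀ → ∀ Φ : (N : ℕ) → Literature.Analysis.FluidPDE.HardSphereFlow (Literature.Analysis.FluidPDE.Torus.geometry (Fin 3)) (Literature.MathematicalPhysics.KineticTheory.hsDiameter σ N) (N + 1), ∀ (γ C : ℝ) (φ : ℕ → (UnitAddTorus (Fin 3)) → ℝ), 0 < γ → γ ≤ 1 / 15 → ((∀ N, Literature.Analysis.FunctionSpaces.Torus.IsSmooth (φ N)) ∧ (∀ N y, 0 ≤ φ N y) ∧ (∀ N, ∫ y, φ N y = 1) ∧ (∀ (N : ℕ) y, ((N : ℝ) + 1) ^ (-γ) ≤ Literature.Analysis.FluidPDE.Torus.euclidDist y 0 → φ N y = 0) ∧ (∀ (N : ℕ) y, φ N y ≤ C * ((N : ℝ) + 1) ^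 (3 * γ)) ∧ (∀ (N : ℕ) y, ‖Literature.Analysis.FunctionSpaces.Torus.gradient (φ N) y‖ ≤ C * ((N : ℝ) + 1) ^ (4 * γ))) → let ρb := fun (N : ℕ) (z : Literature.Analysis.FluidPDE.Config (N + 1) (Fin 3) (UnitAddTorus (Fin 3))) (x : (UnitAddTorus (Fin 3))) => Literature.MathematicalPhysics.KineticTheory.empiricalDensityField z (fun y => φ N (y - x)); let mb := fun (N : ℕ) (z : Literature.Analysis.FluidPDE.Config (N + 1) (Fin 3) (UnitAddTorus (Fin 3))) (x : (UnitAddTorus (Fin 3))) => Literature.MathematicalPhysics.KineticTheory.empiricalMomentumField z (fun y => φ N (y - x)); let ub := fun (N : ℕ) (z : Literature.Analysis.FluidPDE.Config (N + 1) (Fin 3) (UnitAddTorus (Fin 3))) (x : (UnitAddTorus (Fin 3))) => (ρb N z x)⁻¹ • mb N z x; let D := fun (N : ℕ) (z : Literature.Analysis.FluidPDE.Config (N + 1) (Fin 3) (UnitAddTorus (Fin 3))) (x : (UnitAddTorus (Fin 3))) (j k : Fin 3) => (∫ y, φ N (y.1 - x) * ((y.2 j - ub N z x j) * (y.2 k -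 ub N z x k)) ∂(Literature.Analysis.FluidPDE.empiricalMeasure z)) - (if j = k then (∑ l : Fin 3, ∫ y, φ N (y.1 - x) * (y.2 l - ub N z x l) ^ 2 ∂(Literature.Analysis.FluidPDE.empiricalMeasure z)) / 3 else 0); let q := fun (N : ℕ) (z : Literature.Analysis.FluidPDE.Config (N + 1) (Fin 3) (UnitAddTorus (Fin 3))) (x : (UnitAddTorus (Fin 3))) => ∫ y, (φ N (y.1 - x) * ‖y.2 - ub N z x‖ ^ 2 / 2) • (y.2 - ub N z x) ∂(Literature.Analysis.FluidPDE.empiricalMeasure z); ∀ t : ℝ, 0 < t → ∀ δ : ℝ, 0 < δ → ∀ lam Cexp : ℝ, 0 < lam → ∀ c : ℝ, ∀ᶠ N : ℕ in atTop, Literature.MathematicalPhysics.KineticTheory.localGibbsLaw σ a₀ u₀ θ₀ N (Φ N) {z | δ < ∫ s in Icc 0 t, ∫ x, ((∑ j, ∑ k, D N ((Φ N).flow s z) x j k ^ 2) + ‖q N ((Φ N).flow s z) x‖ ^ 2) ∧ (∫ s in Icc 0 t, ∫ y, Real.exp (lam * ‖y.2‖ ^ 2) ∂(Literature.Analysis.FluidPDE.empiricalMeasure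 ((Φ N).flow s z))) ≤ Cexp} ≤ ENNReal.ofReal (Real.exp (-(c * ((N : ℝ) + 1))))

end Summit.AtomisticToContinuum.HydrodynamicLimit.Cruxes.AdaptedWeightCLT.Ideas
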